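import Literature.Probability.LatticeModels.AizenmanWickSplice
import Literature.Probability.LatticeModels.TreeGraphWickTuples
import HarnessLib

/-!
# Aizenman's bound on the deviation from Wick's law by random currents — I: the disjoint-cluster functional

Topic `Literature/Probability/LatticeModels`. Edge couplings `K ≥ 0` on a finite simple graph `G`; labelled points
`x : ι → V` indexed by a linearly ordered index type (repetitions allowed). This file and its sequel
`AizenmanWickCurrentsExcess.lean` prove Aizenman's Proposition 12.1 (Comm. Math. Phys. 86 (1982)),
`𝒢[S₂](x) - S(x) ≤ (3/2) ∑_{|s|=4} |U₄(x_s)| 𝒢[S₂](x_{s̸})`, by a random-current argument of ours replacing the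
random-walk representation of [Aiz82, §9]: the `2n`-point function is compared with the **disjoint-cluster
functional**

  `𝔇(I; X) = 𝟙[I = ∅] + ∑_{b ∈ I∖m} ∑_{n : ∂n = {x_m}Δ{x_b}, C_n(x_m) ∩ X = ∅} w(n) · 𝔇(I∖{m,b}; X ∪ C_n(x_m))`

(`m = min I`; greedy pairing of the least index, the clusters of the successive pair currents being required to
avoid each other and `X`), which is squeezed between the correlation and the Gaussian functional:
`𝔇(I;∅)/Z^{|I|/2} ≤ ⟨∏_{i∈I} σ_{x_i}⟩` (this file, `dcMass_mul_ecurrentSumIn_le`: conditioning on the clusters,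
Griffiths' monotonicity `cmass_empty_mul_le` of `AizenmanWickSplice.lean`, and disjointness of the events over the
partner `b`), while its excess under one Gaussian step is controlled by pairs of intersecting source clusters,
hence by `|U₄|` (the sequel).

## Contents

* the odd support `oddSupp x I = Δ_{i∈I} {x_i}` is the tree's (`TreeGraphWickTuples.lean`; `oddSupp_eq_pair_symmDiff`);
* `avoidWeight`, `hitWeight` — `𝟙[∂n = {a}Δ{c}] w(n)` split according to `C_n(a) ∩ X = ∅` or not;
* `epairing K x I` — the unnormalised Gaussian functional `∑_{pairings} ∏ Z[{x_i}Δ{x_j}]` (least-element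
  recursion, as `fsPairing` of `TreeGraphWickBound.lean`); `dcMass K x I X = 𝔇(I;X)`; `defect K x I X`;
* `dcMass_le_epairing`, `dcMass_eq_zero_of_mem` (an index whose point lies in `X` kills `𝔇`),
  `dcMass_mul_ecurrentSumIn_le` (domination by the correlation), `dcMass_le_dcMass_union_add_defect`
  (`𝔇(I;X₀) ≤ 𝔇(I;X₀∪X) + E(I;X)`).

## References

* M. Aizenman, Comm. Math. Phys. 86 (1982) 1–48, Prop. 12.1, Lemmas 9.2–9.3 [AizenmanCMP1982] (read, pp. 23–27,
  36–39; Project Euclid). The random-current reformulation is ours; the Griffiths input is the same as in Lemma 9.3.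
* R. Panis, arXiv:2309.05797 (2023), Prop. 4.6 [Panis2023Triviality] (statement; no proof there).
-/

noncomputable section

open Finset Filter
open scoped symmDiff ENNReal

namespace Literature.Probability.LatticeModels

namespace Current

variable {V : Type*} [Fintype V] [DecidableEq V] {G : SimpleGraph V} [DecidableRel G.Adj]

/-! ### The odd support of labelled points (`oddSupp` of `TreeGraphWickTuples.lean`) -/

section OddSupp

variable {κ : Type*} [DecidableEq κ]

omit [Fintype V] in
/-- **Removing the least label and its partner** (from `oddSupp_erase_erase` of `TreeGraphWickTuples.lean`):
`oddSupp x I = ({x m} Δ {x b}) Δ oddSupp x (I ∖ {m,b})`. [folklore] -/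
theorem oddSupp_eq_pair_symmDiff [Fintype V] (x : κ → V) {I : Finset κ} {m b : κ} (hm : m ∈ I) (hb : b ∈ I.erase m) :
    oddSupp x I = ({x m} ∆ {x b}) ∆ oddSupp x ((I.erase m).erase b) := by
  rw [oddSupp_erase_erase hm (Finset.mem_of_mem_erase hb) (Finset.ne_of_mem_erase hb).symm]
  ext v
  simp only [Finset.mem_symmDiff, Finset.mem_singleton]
  tauto

end OddSupp

variable {ι : Type*} [LinearOrder ι]
variable {K : G.edgeFinset → ℝ}

/-! ### Pair weights split by a cluster condition -/

/-- `𝟙[∂n = {a}Δ{c}] 𝟙[C_n(a) ∩ X = ∅] w_K(n)`. [folklore] -/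
def avoidWeight (K : G.edgeFinset → ℝ) (a c : V) (X : Finset V) (n : Current G) : ℝ≥0∞ :=
  if n.sources = {a} ∆ {c} ∧ Disjoint (n.cluster a) X then n.eweight K else 0

/-- `𝟙[∂n = {a}Δ{c}] 𝟙[C_n(a) ∩ X ≠ ∅] w_K(n)`. [folklore] -/
def hitWeight (K : G.edgeFinset → ℝ) (a c : V) (X : Finset V) (n : Current G) : ℝ≥0∞ :=
  if n.sources = {a} ∆ {c} ∧ ¬ Disjoint (n.cluster a) X then n.eweight K else 0

/-- The two pieces add up to `𝟙[∂n = {a}Δ{c}] w_K(n)`. [folklore] -/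
theorem avoidWeight_add_hitWeight (K : G.edgeFinset → ℝ) (a c : V) (X : Finset V) (n : Current G) :
    avoidWeight K a c X n + hitWeight K a c X n = if n.sources = {a} ∆ {c} then n.eweight K else 0 := by
  unfold avoidWeight hitWeight
  by_cases hs : n.sources = {a} ∆ {c} <;> by_cases hd : Disjoint (n.cluster a) X <;> simp [hs, hd]

/-- With nothing to avoid, `avoidWeight` is the plain pair weight. [folklore] -/
theorem avoidWeight_empty (K : G.edgeFinset → ℝ) (a c : V) (n : Current G) :
    avoidWeight K a c ∅ n = if n.sources = {a} ∆ {c} then n.eweight K else 0 := by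
  unfold avoidWeight
  by_cases hs : n.sources = {a} ∆ {c} <;> simp [hs]

/-- `∑_n avoidWeight ≤ Z[{a}Δ{c}]`. [folklore] -/
theorem tsum_avoidWeight_le (K : G.edgeFinset → ℝ) (a c : V) (X : Finset V) :
    ∑' n, avoidWeight K a c X n ≤ ecurrentSum K ({a} ∆ {c}) := by
  unfold avoidWeight ecurrentSum
  refine ENNReal.tsum_le_tsum fun n => ?_
  by_cases h : n.sources = {a} ∆ {c} ∧ Disjoint (n.cluster a) X
  · rw [if_pos h, if_pos h.1]
  · rw [if_neg h]; exact bot_le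

/-- `∑_n hitWeight ≤ Z[{a}Δ{c}]`. [folklore] -/
theorem tsum_hitWeight_le (K : G.edgeFinset → ℝ) (a c : V) (X : Finset V) :
    ∑' n, hitWeight K a c X n ≤ ecurrentSum K ({a} ∆ {c}) := by
  unfold hitWeight ecurrentSum
  refine ENNReal.tsum_le_tsum fun n => ?_
  by_cases h : n.sources = {a} ∆ {c} ∧ ¬ Disjoint (n.cluster a) X
  · rw [if_pos h, if_pos h.1]
  · rw [if_neg h]; exact bot_le

/-- Enlarging the avoided set shrinks `avoidWeight` by at most `hitWeight` of the added part:
`avoidWeight X₀ ≤ avoidWeight (X₀ ∪ X) + hitWeight X`. [folklore] -/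
theorem avoidWeight_le_add (K : G.edgeFinset → ℝ) (a c : V) (X₀ X : Finset V) (n : Current G) :
    avoidWeight K a c X₀ n ≤ avoidWeight K a c (X₀ ∪ X) n + hitWeight K a c X n := by
  unfold avoidWeight hitWeight
  by_cases hs : n.sources = {a} ∆ {c}
  · by_cases hX : Disjoint (n.cluster a) X
    · by_cases h0 : Disjoint (n.cluster a) X₀
      · rw [if_pos ⟨hs, h0⟩, if_pos ⟨hs, Finset.disjoint_union_right.2 ⟨h0, hX⟩⟩]; exact le_self_add
      · rw [if_neg fun h => h0 h.2]; exact bot_le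
    · rw [if_pos (show n.sources = {a} ∆ {c} ∧ ¬ Disjoint (n.cluster a) X from ⟨hs, hX⟩)]
      calc (if n.sources = {a} ∆ {c} ∧ Disjoint (n.cluster a) X₀ then n.eweight K else 0) ≤ n.eweight K := by
            split_ifs <;> simp
        _ ≤ _ := le_add_self
  · rw [if_neg fun h => hs h.1]; exact bot_le

/-! ### The recursive functionals -/

section Defs

variable (K) (x : ι → V)

/-- Termination of the least-element recursions: `|I ∖ {m, j}| < |I|`. [folklore] -/
theorem card_erase_erase_lt {I : Finset ι} (hI : I.Nonempty) (j : {j // j ∈ I.erase (I.min' hI)}) :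
    (((I.erase (I.min' hI)).erase (j : ι)).card) < I.card :=
  calc ((I.erase (I.min' hI)).erase ↑j).card < (I.erase (I.min' hI)).card := Finset.card_erase_lt_of_mem j.2
    _ < I.card := Finset.card_erase_lt_of_mem (I.min'_mem hI)

/-- **The unnormalised Gaussian functional** `Z^{|I|/2} 𝒢[⟨σσ⟩](x|_I) = ∑_{pairings π of I} ∏_{{i,j}∈π} Z[{x_i}Δ{x_j}]`,
by the least-element recursion `ℰ(∅) = 1`, `ℰ(I) = ∑_{b∈I∖m} Z[{x_m}Δ{x_b}] ℰ(I∖{m,b})`. [cite: AizenmanCMP1982, §12 (the Gaussian component G_{2n})] -/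
def epairing (I : Finset ι) : ℝ≥0∞ :=
  if hI : I.Nonempty then
    ∑ b ∈ (I.erase (I.min' hI)).attach,
      ecurrentSum K ({x (I.min' hI)} ∆ {x b}) * epairing ((I.erase (I.min' hI)).erase b)
  else 1
termination_by I.card
decreasing_by exact card_erase_erase_lt hI b

/-- **The disjoint-cluster functional** `𝔇(I;X)`: `𝔇(∅;X) = 1` and
`𝔇(I;X) = ∑_{b∈I∖m} ∑_{n : ∂n = {x_m}Δ{x_b}, C_n(x_m) ∩ X = ∅} w(n) 𝔇(I∖{m,b}; X ∪ C_n(x_m))` — the least index is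
paired greedily, the clusters of the successive pair currents avoiding each other and `X`. [cite: AizenmanCMP1982, Prop. 12.1 (proof, compatible walks)] -/
def dcMass (I : Finset ι) (X : Finset V) : ℝ≥0∞ :=
  if hI : I.Nonempty then
    ∑ b ∈ (I.erase (I.min' hI)).attach,
      ∑' n : Current G, avoidWeight K (x (I.min' hI)) (x b) X n *
        dcMass ((I.erase (I.min' hI)).erase b) (X ∪ n.cluster (x (I.min' hI)))
  else 1
termination_by I.card
decreasing_by exact card_erase_erase_lt hI b

/-- **The defect functional** `E(I;X)`, bounding `𝔇(I;X₀) - 𝔇(I;X₀∪X)`: `E(∅;X) = 0` and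
`E(I;X) = ∑_{b∈I∖m} [ (∑_{n : ∂n={x_m}Δ{x_b}, C_n(x_m)∩X≠∅} w(n)) ℰ(I∖{m,b}) + Z[{x_m}Δ{x_b}] E(I∖{m,b};X) ]`
(one source cluster meets `X`, all other pairs unconstrained). [cite: AizenmanCMP1982, Prop. 12.1 (proof, eq. (12.5))] -/
def defect (I : Finset ι) (X : Finset V) : ℝ≥0∞ :=
  if hI : I.Nonempty then
    ∑ b ∈ (I.erase (I.min' hI)).attach,
      ((∑' n : Current G, hitWeight K (x (I.min' hI)) (x b) X n) * epairing K x ((I.erase (I.min' hI)).erase b) +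
        ecurrentSum K ({x (I.min' hI)} ∆ {x b}) * defect ((I.erase (I.min' hI)).erase b) X)
  else 0
termination_by I.card
decreasing_by exact card_erase_erase_lt hI b

variable {K x}

/-- `ℰ(∅) = 1`. [folklore] -/
@[simp] theorem epairing_empty : epairing K x (∅ : Finset ι) = 1 := by
  rw [epairing, dif_neg Finset.not_nonempty_empty]

/-- The recursion of `ℰ` at the least element. [folklore] -/
theorem epairing_eq {I : Finset ι} (hI : I.Nonempty) :
    epairing K x I = ∑ b ∈ I.erase (I.min' hI),
      ecurrentSum K ({x (I.min' hI)} ∆ {x b}) * epairing K x ((I.erase (I.min' hI)).erase b) := by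
  rw [epairing, dif_pos hI, Finset.sum_attach (I.erase (I.min' hI))
    (fun b => ecurrentSum K ({x (I.min' hI)} ∆ {x b}) * epairing K x ((I.erase (I.min' hI)).erase b))]

/-- `𝔇(∅;X) = 1`. [folklore] -/
@[simp] theorem dcMass_empty (X : Finset V) : dcMass K x (∅ : Finset ι) X = 1 := by
  rw [dcMass, dif_neg Finset.not_nonempty_empty]

/-- The recursion of `𝔇` at the least element. [folklore] -/
theorem dcMass_eq {I : Finset ι} (hI : I.Nonempty) (X : Finset V) :
    dcMass K x I X = ∑ b ∈ I.erase (I.min' hI), ∑' n : Current G,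
      avoidWeight K (x (I.min' hI)) (x b) X n * dcMass K x ((I.erase (I.min' hI)).erase b) (X ∪ n.cluster (x (I.min' hI))) := by
  rw [dcMass, dif_pos hI, Finset.sum_attach (I.erase (I.min' hI)) (fun b => ∑' n : Current G,
    avoidWeight K (x (I.min' hI)) (x b) X n * dcMass K x ((I.erase (I.min' hI)).erase b) (X ∪ n.cluster (x (I.min' hI))))]

/-- `E(∅;X) = 0`. [folklore] -/
@[simp] theorem defect_empty (X : Finset V) : defect K x (∅ : Finset ι) X = 0 := by
  rw [defect, dif_neg Finset.not_nonempty_empty]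

/-- The recursion of `E` at the least element. [folklore] -/
theorem defect_eq {I : Finset ι} (hI : I.Nonempty) (X : Finset V) :
    defect K x I X = ∑ b ∈ I.erase (I.min' hI),
      ((∑' n : Current G, hitWeight K (x (I.min' hI)) (x b) X n) * epairing K x ((I.erase (I.min' hI)).erase b) +
        ecurrentSum K ({x (I.min' hI)} ∆ {x b}) * defect K x ((I.erase (I.min' hI)).erase b) X) := by
  rw [defect, dif_pos hI, Finset.sum_attach (I.erase (I.min' hI)) (fun b =>
    (∑' n : Current G, hitWeight K (x (I.min' hI)) (x b) X n) * epairing K x ((I.erase (I.min' hI)).erase b) +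
      ecurrentSum K ({x (I.min' hI)} ∆ {x b}) * defect K x ((I.erase (I.min' hI)).erase b) X)]

end Defs

/-! ### Elementary bounds -/

/-- `ℰ(I) < ∞` (`K ≥ 0`). [folklore] -/
theorem epairing_ne_top (hK : ∀ e, 0 ≤ K e) (x : ι → V) : ∀ I : Finset ι, epairing K x I ≠ ∞ := by
  intro I
  induction I using Finset.strongInduction with
  | H I ih =>
    by_cases hI : I.Nonempty
    · rw [epairing_eq hI]
      exact ENNReal.sum_ne_top.2 fun b _ =>
        ENNReal.mul_ne_top (ecurrentSum_ne_top hK _) (ih _ (erase_erase_ssubset (I.min'_mem hI) b))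
    · rw [Finset.not_nonempty_iff_eq_empty.1 hI, epairing_empty]; exact ENNReal.one_ne_top

/-- **`𝔇 ≤ ℰ`**: dropping the cluster constraints. [folklore] -/
theorem dcMass_le_epairing (x : ι → V) : ∀ (I : Finset ι) (X : Finset V), dcMass K x I X ≤ epairing K x I := by
  intro I
  induction I using Finset.strongInduction with
  | H I ih =>
    intro X
    by_cases hI : I.Nonempty
    · rw [dcMass_eq hI, epairing_eq hI]
      refine Finset.sum_le_sum fun b _ => ?_
      calc ∑' n : Current G, avoidWeight K (x (I.min' hI)) (x b) X n *
            dcMass K x ((I.erase (I.min' hI)).erase b) (X ∪ n.cluster (x (I.min' hI)))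
          ≤ ∑' n : Current G, avoidWeight K (x (I.min' hI)) (x b) X n * epairing K x ((I.erase (I.min' hI)).erase b) :=
            ENNReal.tsum_le_tsum fun n => mul_le_mul' le_rfl (ih _ (erase_erase_ssubset (I.min'_mem hI) b) _)
        _ ≤ ecurrentSum K ({x (I.min' hI)} ∆ {x b}) * epairing K x ((I.erase (I.min' hI)).erase b) := by
            rw [ENNReal.tsum_mul_right]
            exact mul_le_mul' (tsum_avoidWeight_le K _ _ X) le_rfl
    · rw [Finset.not_nonempty_iff_eq_empty.1 hI, dcMass_empty, epairing_empty]

/-- `𝔇(I;X) < ∞` (`K ≥ 0`). [folklore] -/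
theorem dcMass_ne_top (hK : ∀ e, 0 ≤ K e) (x : ι → V) (I : Finset ι) (X : Finset V) : dcMass K x I X ≠ ∞ :=
  ne_top_of_le_ne_top (epairing_ne_top hK x I) (dcMass_le_epairing x I X)

/-- **An index whose point lies in the avoided set kills `𝔇`**: if `x_i ∈ X` for some `i ∈ I` then
`𝔇(I;X) = 0` (when `i` comes to be paired, its source cluster contains `x_i ∈ X`). [folklore] -/
theorem dcMass_eq_zero_of_mem (x : ι → V) :
    ∀ (I : Finset ι) (X : Finset V), (∃ i ∈ I, x i ∈ X) → dcMass K x I X = 0 := by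
  intro I
  induction I using Finset.strongInduction with
  | H I ih =>
    intro X hex
    obtain ⟨i, hiI, hiX⟩ := hex
    have hI : I.Nonempty := ⟨i, hiI⟩
    rw [dcMass_eq hI]
    refine Finset.sum_eq_zero fun b hb => ENNReal.tsum_eq_zero.2 fun n => ?_
    by_cases hw : n.sources = {x (I.min' hI)} ∆ {x b} ∧ Disjoint (n.cluster (x (I.min' hI))) X
    · -- `x_m, x_b ∈ C_n(x_m)`, so `i ≠ m, b`, and `i` survives in `I ∖ {m,b}` with `X ⊆ X ∪ C`
      have hmC : x (I.min' hI) ∈ n.cluster (x (I.min' hI)) := mem_cluster_self n _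
      have hbC : x b ∈ n.cluster (x (I.min' hI)) := mem_cluster_of_sources_eq hw.1
      have him : i ≠ I.min' hI := fun h => Finset.disjoint_left.1 hw.2 hmC (h ▸ hiX)
      have hib : i ≠ b := fun h => Finset.disjoint_left.1 hw.2 hbC (h ▸ hiX)
      have hi' : i ∈ (I.erase (I.min' hI)).erase b := Finset.mem_erase.2 ⟨hib, Finset.mem_erase.2 ⟨him, hiI⟩⟩
      rw [ih _ (erase_erase_ssubset (I.min'_mem hI) b) _ ⟨i, hi', Finset.mem_union_left _ hiX⟩, mul_zero]
    · rw [avoidWeight, if_neg hw, zero_mul]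

/-! ### Domination of `𝔇` by the correlation -/

section Domination

/-- `∑_n avoidWeight(n) 𝟙[C_n(a) = C]` is the unrestricted cluster-conditioned mass when `C` avoids `X`, and
vanishes otherwise. [folklore] -/
theorem tsum_avoidWeight_mul_indicator (K : G.edgeFinset → ℝ) (a c : V) (X C : Finset V) :
    ∑' n, avoidWeight K a c X n * (if n.cluster a = C then 1 else 0) =
      if Disjoint C X then cmass K ∅ ({a} ∆ {c}) a C else 0 := by
  have hR : (if Disjoint C X then cmass K ∅ ({a} ∆ {c}) a C else 0) = ∑' n : Current G,
      (if Disjoint C X then (if IsSupp (offGraph G ∅) n ∧ n.sources = {a} ∆ {c} ∧ n.cluster a = C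
        then n.eweight K else 0) else 0) := by
    unfold cmass
    split_ifs
    · rfl
    · exact tsum_zero.symm
  rw [hR]
  refine tsum_congr fun n => ?_
  have hs0 := isSupp_offGraph_empty n
  unfold avoidWeight
  by_cases hC : n.cluster a = C
  · subst hC
    by_cases hs : n.sources = {a} ∆ {c} <;> by_cases hD : Disjoint (n.cluster a) X <;> simp [hs, hD, hs0]
  · rw [if_neg hC, mul_zero]
    split_ifs with hD h
    · exact absurd h.2.2 hC
    · rfl
    · rfl

/-- The per-cluster step of the domination: for `C` avoiding `X`, all points of the remaining labels `I'` off
`C`, `x_a, x_c ∈ C`: `M_∅[{x_a}Δ{x_c}](C) · (Z_{G∖(X∪C)}[oddSupp I'] Z^{k} / Z_{G∖(X∪C)}[∅]) · Z_{G∖X}[∅]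
≤ Z^{k+1} M_X[{x_a}Δ{x_c} ∪ oddSupp I'](C)` (Griffiths monotonicity and the splice identity,
`cmass_empty_mul_mul_le`). [cite: AizenmanCMP1982, Lemma 9.2 and Lemma 9.3] -/
theorem cmass_step_le (hK : ∀ e, 0 ≤ K e) {X C : Finset V} {a c : V} {A' : Finset V} (k : ℕ)
    (hCX : Disjoint C X) (haC : a ∈ C) (hcC : c ∈ C) (hA' : Disjoint A' C) :
    cmass K ∅ ({a} ∆ {c}) a C *
        (ecurrentSumIn (offGraph G (X ∪ C)) K A' * ecurrentSum K ∅ ^ k / ecurrentSumIn (offGraph G (X ∪ C)) K ∅) *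
        ecurrentSumIn (offGraph G X) K ∅ ≤
      ecurrentSum K ∅ ^ (k + 1) * cmass K X (({a} ∆ {c}) ∪ A') a C := by
  have hAC : {a} ∆ {c} ⊆ C := fun v hv => by
    rcases eq_or_eq_of_mem_symmDiff_singleton hv with rfl | rfl
    · exact haC
    · exact hcC
  set d := ecurrentSumIn (offGraph G (X ∪ C)) K ∅ with hd
  have hd0 : d ≠ 0 := ecurrentSumIn_empty_ne_zero _ K
  have hdtop : d ≠ ∞ := ecurrentSumIn_ne_top _ hK ∅
  have key := cmass_empty_mul_mul_le hK (a := a) (B := A') hCX hAC hA'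
  calc cmass K ∅ ({a} ∆ {c}) a C * (ecurrentSumIn (offGraph G (X ∪ C)) K A' * ecurrentSum K ∅ ^ k / d) *
        ecurrentSumIn (offGraph G X) K ∅
      = (cmass K ∅ ({a} ∆ {c}) a C * ecurrentSumIn (offGraph G X) K ∅ * ecurrentSumIn (offGraph G (X ∪ C)) K A') *
          ecurrentSum K ∅ ^ k / d := by
        rw [div_eq_mul_inv, div_eq_mul_inv]; ring
    _ ≤ (ecurrentSum K ∅ * (cmass K X (({a} ∆ {c}) ∪ A') a C * d)) * ecurrentSum K ∅ ^ k / d :=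
        ENNReal.div_le_div_right (mul_le_mul' key le_rfl) d
    _ = ecurrentSum K ∅ * cmass K X (({a} ∆ {c}) ∪ A') a C * ecurrentSum K ∅ ^ k * d / d := by ring_nf
    _ = ecurrentSum K ∅ * cmass K X (({a} ∆ {c}) ∪ A') a C * ecurrentSum K ∅ ^ k := ENNReal.mul_div_cancel_right hd0 hdtop
    _ = ecurrentSum K ∅ ^ (k + 1) * cmass K X (({a} ∆ {c}) ∪ A') a C := by ring

omit [Fintype V] in
/-- Disjointness of the partner events: for a fixed cluster `C`, at most one label `b ∈ I'` has its point in `C`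
while all the other labels of `I' ∖ b` have theirs off `C`. [folklore] -/
theorem card_filter_partner_le_one (x : ι → V) (I' : Finset ι) (C : Finset V) :
    (I'.filter fun b => x b ∈ C ∧ ∀ i ∈ I'.erase b, x i ∉ C).card ≤ 1 := by
  refine Finset.card_le_one.2 fun b₁ h₁ b₂ h₂ => ?_
  by_contra hne
  obtain ⟨-, hb₁, h₁'⟩ := Finset.mem_filter.1 h₁
  obtain ⟨hb₂I, hb₂, -⟩ := Finset.mem_filter.1 h₂
  exact h₁' b₂ (Finset.mem_erase.2 ⟨Ne.symm hne, hb₂I⟩) hb₂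

/-- **Domination of the disjoint-cluster functional by the correlation** (conditioning on the clusters and
Griffiths' inequality): for `K ≥ 0`, every label set `I` and every avoided set `X`,
`𝔇(I;X) · Z_{G∖X}[∅] ≤ Z_{G∖X}[oddSupp x I] · Z_G[∅]^{|I|/2}`; in particular (`X = ∅`)
`𝔇(I;∅)/Z[∅]^{|I|/2} ≤ Z[oddSupp x I]/Z[∅] = ⟨∏_{i∈I} σ_{x_i}⟩`. Induction on `|I|`: the least label `m` is paired
with `b`, the pair current is conditioned on its cluster `C = C_n(x_m)` (`tsum_avoidWeight_mul_indicator`), the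
induction hypothesis off `X ∪ C` and the vanishing `dcMass_eq_zero_of_mem` bound the continuation, Griffiths'
monotonicity moves the conditioned current off `X` and absorbs the sources `oddSupp(I∖{m,b})` (`cmass_step_le`),
and for a given total current the partner `b` is determined (`card_filter_partner_le_one`).
[cite: AizenmanCMP1982, Prop. 12.1 with Lemmas 9.2–9.3] -/
theorem dcMass_mul_ecurrentSumIn_le (hK : ∀ e, 0 ≤ K e) (x : ι → V) :
    ∀ (I : Finset ι) (X : Finset V), dcMass K x I X * ecurrentSumIn (offGraph G X) K ∅ ≤
      ecurrentSumIn (offGraph G X) K (oddSupp x I) * ecurrentSum K ∅ ^ (I.card / 2) := by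
  intro I
  induction I using Finset.strongInduction with
  | H I ih =>
    intro X
    by_cases hI : I.Nonempty
    swap
    · rw [Finset.not_nonempty_iff_eq_empty.1 hI, dcMass_empty, oddSupp_empty, Finset.card_empty, Nat.zero_div,
        pow_zero, one_mul, mul_one]
    set m := I.min' hI with hm
    set I' := I.erase m with hI'
    have hmI : m ∈ I := I.min'_mem hI
    set Z := ecurrentSum K (∅ : Finset V) with hZ
    -- the bound for each partner `b`
    have hb : ∀ b ∈ I', (∑' n : Current G, avoidWeight K (x m) (x b) X n *
        dcMass K x (I'.erase b) (X ∪ n.cluster (x m))) * ecurrentSumIn (offGraph G X) K ∅ ≤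
        Z ^ (I.card / 2) * ∑ C : Finset V,
          (if x b ∈ C ∧ ∀ i ∈ I'.erase b, x i ∉ C then cmass K X (oddSupp x I) (x m) C else 0) := by
      intro b hbI'
      set J := I'.erase b with hJ
      set A' := oddSupp x J with hA'
      set k := J.card / 2 with hk
      have hcard : I.card / 2 = k + 1 := by
        have h1 : J.card = I.card - 2 := by
          rw [hJ, Finset.card_erase_of_mem hbI', hI', Finset.card_erase_of_mem hmI]; omega
        have h2 : 2 ≤ I.card := by
          have := Finset.card_pos.2 ⟨b, hbI'⟩
          rw [hI', Finset.card_erase_of_mem hmI] at this; omega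
        omega
      -- the continuation bound `R C`
      set R : Finset V → ℝ≥0∞ := fun C => if ∀ i ∈ J, x i ∉ X ∪ C then
        ecurrentSumIn (offGraph G (X ∪ C)) K A' * Z ^ k / ecurrentSumIn (offGraph G (X ∪ C)) K ∅ else 0 with hR
      have hcont : ∀ n : Current G, dcMass K x J (X ∪ n.cluster (x m)) ≤ R (n.cluster (x m)) := by
        intro n
        simp only [hR]
        split_ifs with hall
        · rw [ENNReal.le_div_iff_mul_le (Or.inl (ecurrentSumIn_empty_ne_zero _ K))
            (Or.inl (ecurrentSumIn_ne_top _ hK ∅))]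
          exact ih J (hJ ▸ erase_erase_ssubset hmI b) _
        · push Not at hall
          obtain ⟨i, hi, hiX⟩ := hall
          rw [dcMass_eq_zero_of_mem x J _ ⟨i, hi, hiX⟩]
      -- per cluster
      have hC : ∀ C : Finset V, (if Disjoint C X then cmass K ∅ ({x m} ∆ {x b}) (x m) C else 0) * R C *
          ecurrentSumIn (offGraph G X) K ∅ ≤
          Z ^ (k + 1) * (if x b ∈ C ∧ ∀ i ∈ J, x i ∉ C then cmass K X (oddSupp x I) (x m) C else 0) := by
        intro C
        by_cases hCX : Disjoint C X
        swap
        · rw [if_neg hCX, zero_mul, zero_mul]; exact bot_le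
        rw [if_pos hCX]
        simp only [hR]
        by_cases hall : ∀ i ∈ J, x i ∉ X ∪ C
        swap
        · rw [if_neg hall, mul_zero, zero_mul]; exact bot_le
        rw [if_pos hall]
        have hall' : ∀ i ∈ J, x i ∉ C := fun i hi h => hall i hi (Finset.mem_union_right _ h)
        by_cases hbC : x b ∈ C
        swap
        · rw [cmass_pair_eq_zero_of_not_mem K hbC, zero_mul, zero_mul]; exact bot_le
        by_cases hmC : x m ∈ C
        swap
        · rw [cmass_eq_zero_of_not_mem_self K hmC, zero_mul, zero_mul]; exact bot_le
        rw [if_pos ⟨hbC, hall'⟩]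
        have hA'C : Disjoint A' C := Finset.disjoint_left.2 fun v hv hvC => by
          obtain ⟨i, hi, rfl⟩ := exists_mem_of_mem_oddSupp hv
          exact hall' i hi hvC
        have hpairA' : Disjoint ({x m} ∆ {x b}) A' := Finset.disjoint_left.2 fun v hv hvA => by
          obtain ⟨i, hi, rfl⟩ := exists_mem_of_mem_oddSupp hvA
          rcases eq_or_eq_of_mem_symmDiff_singleton hv with h | h
          · exact hall' i hi (h ▸ hmC)
          · exact hall' i hi (h ▸ hbC)
        have hoddSupp : oddSupp x I = ({x m} ∆ {x b}) ∪ A' := by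
          rw [hA', hJ, hI', oddSupp_eq_pair_symmDiff x hmI hbI', ← hI', ← hJ]
          exact hpairA'.symmDiff_eq_sup
        rw [hoddSupp]
        exact cmass_step_le hK k hCX hmC hbC hA'C
      -- assemble the bound for `b`
      calc (∑' n : Current G, avoidWeight K (x m) (x b) X n * dcMass K x J (X ∪ n.cluster (x m))) *
            ecurrentSumIn (offGraph G X) K ∅
          ≤ (∑' n : Current G, avoidWeight K (x m) (x b) X n * R (n.cluster (x m))) *
              ecurrentSumIn (offGraph G X) K ∅ :=
            mul_le_mul' (ENNReal.tsum_le_tsum fun n => mul_le_mul' le_rfl (hcont n)) le_rfl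
        _ = (∑ C : Finset V, (if Disjoint C X then cmass K ∅ ({x m} ∆ {x b}) (x m) C else 0) * R C) *
              ecurrentSumIn (offGraph G X) K ∅ := by
            rw [tsum_mul_apply_cluster_eq_sum]
            simp only [tsum_avoidWeight_mul_indicator]
        _ = ∑ C : Finset V, (if Disjoint C X then cmass K ∅ ({x m} ∆ {x b}) (x m) C else 0) * R C *
              ecurrentSumIn (offGraph G X) K ∅ := Finset.sum_mul _ _ _
        _ ≤ ∑ C : Finset V, Z ^ (k + 1) *
              (if x b ∈ C ∧ ∀ i ∈ J, x i ∉ C then cmass K X (oddSupp x I) (x m) C else 0) := Finset.sum_le_sum fun C _ => hC C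
        _ = Z ^ (I.card / 2) * ∑ C : Finset V,
              (if x b ∈ C ∧ ∀ i ∈ I'.erase b, x i ∉ C then cmass K X (oddSupp x I) (x m) C else 0) := by
            rw [← Finset.mul_sum, hcard]
    -- sum over the partners and count them per total current
    have hcount : ∑ b ∈ I', ∑ C : Finset V,
        (if x b ∈ C ∧ ∀ i ∈ I'.erase b, x i ∉ C then cmass K X (oddSupp x I) (x m) C else 0) ≤
        ecurrentSumIn (offGraph G X) K (oddSupp x I) := by
      rw [Finset.sum_comm, ← sum_cmass_eq K X (oddSupp x I) (x m)]
      refine Finset.sum_le_sum fun C _ => ?_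
      have h1 : ∑ b ∈ I', (if x b ∈ C ∧ ∀ i ∈ I'.erase b, x i ∉ C then cmass K X (oddSupp x I) (x m) C else 0) =
          ((I'.filter fun b => x b ∈ C ∧ ∀ i ∈ I'.erase b, x i ∉ C).card : ℝ≥0∞) * cmass K X (oddSupp x I) (x m) C := by
        rw [← Finset.sum_filter, Finset.sum_const, nsmul_eq_mul]
      rw [h1]
      calc ((I'.filter fun b => x b ∈ C ∧ ∀ i ∈ I'.erase b, x i ∉ C).card : ℝ≥0∞) * cmass K X (oddSupp x I) (x m) C
          ≤ 1 * cmass K X (oddSupp x I) (x m) C :=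
            mul_le_mul' (by exact_mod_cast card_filter_partner_le_one x I' C) le_rfl
        _ = cmass K X (oddSupp x I) (x m) C := one_mul _
    calc dcMass K x I X * ecurrentSumIn (offGraph G X) K ∅
        = ∑ b ∈ I', (∑' n : Current G, avoidWeight K (x m) (x b) X n *
            dcMass K x (I'.erase b) (X ∪ n.cluster (x m))) * ecurrentSumIn (offGraph G X) K ∅ := by
          rw [dcMass_eq hI X, Finset.sum_mul]
      _ ≤ ∑ b ∈ I', Z ^ (I.card / 2) * ∑ C : Finset V,
            (if x b ∈ C ∧ ∀ i ∈ I'.erase b, x i ∉ C then cmass K X (oddSupp x I) (x m) C else 0) :=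
          Finset.sum_le_sum hb
      _ = Z ^ (I.card / 2) * ∑ b ∈ I', ∑ C : Finset V,
            (if x b ∈ C ∧ ∀ i ∈ I'.erase b, x i ∉ C then cmass K X (oddSupp x I) (x m) C else 0) := by
          rw [Finset.mul_sum]
      _ ≤ Z ^ (I.card / 2) * ecurrentSumIn (offGraph G X) K (oddSupp x I) := mul_le_mul' le_rfl hcount
      _ = ecurrentSumIn (offGraph G X) K (oddSupp x I) * ecurrentSum K ∅ ^ (I.card / 2) := mul_comm _ _

/-- **`𝔇 ≤ correlation`** (`X = ∅`): `𝔇(I;∅) · Z[∅] ≤ Z[oddSupp x I] · Z[∅]^{|I|/2}`.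
[cite: AizenmanCMP1982, Prop. 12.1 with Lemmas 9.2–9.3] -/
theorem dcMass_empty_mul_le (hK : ∀ e, 0 ≤ K e) (x : ι → V) (I : Finset ι) :
    dcMass K x I ∅ * ecurrentSum K ∅ ≤ ecurrentSum K (oddSupp x I) * ecurrentSum K ∅ ^ (I.card / 2) := by
  have h := dcMass_mul_ecurrentSumIn_le hK x I ∅
  have h0 : ∀ A, ecurrentSumIn (offGraph G (∅ : Finset V)) K A = ecurrentSum K A := fun A => by
    unfold ecurrentSumIn ecurrentSum
    exact tsum_congr fun n => by simp [isSupp_offGraph_empty n]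
  rwa [h0, h0] at h

end Domination

/-! ### The defect bound -/

/-- **The defect bound**: `𝔇(I;X₀) ≤ 𝔇(I;X₀ ∪ X) + E(I;X)` — enlarging the avoided set loses at most the
configurations in which one of the source clusters meets the added set `X`, the other pairs being released
(`dcMass_le_epairing`). [cite: AizenmanCMP1982, Prop. 12.1 (proof, eq. (12.5): "there may be more than a single pair")] -/
theorem dcMass_le_dcMass_union_add_defect (x : ι → V) :
    ∀ (I : Finset ι) (X₀ X : Finset V), dcMass K x I X₀ ≤ dcMass K x I (X₀ ∪ X) + defect K x I X := by
  intro I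
  induction I using Finset.strongInduction with
  | H I ih =>
    intro X₀ X
    by_cases hI : I.Nonempty
    swap
    · rw [Finset.not_nonempty_iff_eq_empty.1 hI, dcMass_empty, dcMass_empty, defect_empty, add_zero]
    rw [dcMass_eq hI X₀, dcMass_eq hI (X₀ ∪ X), defect_eq hI X, ← Finset.sum_add_distrib]
    refine Finset.sum_le_sum fun b _ => ?_
    set m := I.min' hI with hm
    set J := (I.erase m).erase b with hJ
    have hJI : J ⊂ I := erase_erase_ssubset (I.min'_mem hI) b
    calc ∑' n : Current G, avoidWeight K (x m) (x b) X₀ n * dcMass K x J (X₀ ∪ n.cluster (x m))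
        ≤ ∑' n : Current G, (avoidWeight K (x m) (x b) (X₀ ∪ X) n + hitWeight K (x m) (x b) X n) *
            dcMass K x J (X₀ ∪ n.cluster (x m)) :=
          ENNReal.tsum_le_tsum fun n => mul_le_mul' (avoidWeight_le_add K _ _ X₀ X n) le_rfl
      _ = ∑' n : Current G, avoidWeight K (x m) (x b) (X₀ ∪ X) n * dcMass K x J (X₀ ∪ n.cluster (x m)) +
            ∑' n : Current G, hitWeight K (x m) (x b) X n * dcMass K x J (X₀ ∪ n.cluster (x m)) := by
          rw [← ENNReal.tsum_add]; exact tsum_congr fun n => add_mul _ _ _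
      _ ≤ ∑' n : Current G, avoidWeight K (x m) (x b) (X₀ ∪ X) n *
              (dcMass K x J ((X₀ ∪ X) ∪ n.cluster (x m)) + defect K x J X) +
            ∑' n : Current G, hitWeight K (x m) (x b) X n * epairing K x J := by
          refine add_le_add (ENNReal.tsum_le_tsum fun n => mul_le_mul' le_rfl ?_)
            (ENNReal.tsum_le_tsum fun n => mul_le_mul' le_rfl (dcMass_le_epairing x J _))
          have h := ih J hJI (X₀ ∪ n.cluster (x m)) X
          rwa [Finset.union_right_comm] at h
      _ = ∑' n : Current G, avoidWeight K (x m) (x b) (X₀ ∪ X) n * dcMass K x J ((X₀ ∪ X) ∪ n.cluster (x m)) +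
            ((∑' n : Current G, avoidWeight K (x m) (x b) (X₀ ∪ X) n) * defect K x J X +
              (∑' n : Current G, hitWeight K (x m) (x b) X n) * epairing K x J) := by
          have e1 : ∑' n : Current G, avoidWeight K (x m) (x b) (X₀ ∪ X) n *
              (dcMass K x J ((X₀ ∪ X) ∪ n.cluster (x m)) + defect K x J X) =
              ∑' n : Current G, avoidWeight K (x m) (x b) (X₀ ∪ X) n * dcMass K x J ((X₀ ∪ X) ∪ n.cluster (x m)) +
                (∑' n : Current G, avoidWeight K (x m) (x b) (X₀ ∪ X) n) * defect K x J X := by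
            rw [← ENNReal.tsum_mul_right, ← ENNReal.tsum_add]
            exact tsum_congr fun n => by rw [mul_add]
          rw [e1, ENNReal.tsum_mul_right, add_assoc]
      _ ≤ ∑' n : Current G, avoidWeight K (x m) (x b) (X₀ ∪ X) n * dcMass K x J ((X₀ ∪ X) ∪ n.cluster (x m)) +
            ((∑' n : Current G, hitWeight K (x m) (x b) X n) * epairing K x J +
              ecurrentSum K ({x m} ∆ {x b}) * defect K x J X) := by
          rw [add_comm ((∑' n : Current G, hitWeight K (x m) (x b) X n) * epairing K x J)]
          exact add_le_add le_rfl (add_le_add (mul_le_mul' (tsum_avoidWeight_le K _ _ _) le_rfl) le_rfl)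

end Current

end Literature.Probability.LatticeModels

end
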